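import Literature.AnabelianGeometry.EtaleTheta.Setting
import Literature.AnabelianGeometry.SemiGraphs.TemperedAnabelianWitness
import Mathlib.Topology.Algebra.OpenSubgroup

/-!
# [EtTh] §1: no `ThetaSetting` has a compact `Π^tp_X` — the degenerate `TemperedCurve` cannot be extended

Mochizuki, *The Étale Theta Function and its Frobenioid-theoretic Manifestations* [EtTh], Publ. RIMS 45
(2009), §1, PRIMS text p.12 (bib key `MochizukiEtTh2009`): "the universal graph-covering of the dual graph of
this special fiber determines […] a natural surjection `Π^tp_X ↠ Z`", `Z ≅ ℤ`, and (proof of Thm. 1.6 (i),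
p.24) "the discreteness of the topological group `Z`".

PROOF-ONLY consistency-boundary companion (abc-iut cell, NV programme; seat abc-iut-w5-d243, on abc-iut-L2-lead's
row «NV(ThetaSetting p)» 2026-08-26T03:04:16Z / 03:13:44Z) of abc-iut-L2-t1's §1 interface `ThetaSetting p`
(`Setting.lean`): the two typed fields `toZ_surjective : Π^tp_X ↠ ℤ` and `isOpen_ker_toZ : Ker = Π^tp_Y open`
already force `Π^tp_X` to be NON-COMPACT (`ThetaSetting.not_compactSpace_piTemp`: an open subgroup of a compact
group has finite index, and `ℤ` is infinite) — as it must be for a genuinely TEMPERED (not profinite)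
fundamental group.  Consequently the only kernel inhabitant of the underlying [SemiAnbd] §6 interface
`TemperedCurve p` in the tree, abc-iut-c312-4's `TemperedCurve.degenerate p` (`Π^temp := G_{ℚ_p}`, compact),
underlies NO `ThetaSetting` (`ThetaSetting.toTemperedCurve_ne_degenerate`): any §1 consistency witness must be
built on a non-compact `Π^tp` (e.g. `G_K × ℤ` with a hand-made profinite completion).  Nothing printed is
asserted; typed ≠ proved; no side taken on [IUTchIII] Cor. 3.12.
-/

namespace Literature.AnabelianGeometry.EtaleTheta

open Literature.AnabelianGeometry.SemiGraphs

variable {p : ℕ} [Fact p.Prime]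

/-- **No `ThetaSetting` has compact `Π^tp_X`**: `Π^tp_X ↠ Z ≅ ℤ` with OPEN kernel `Π^tp_Y` (p.12, p.24) is
impossible on a compact group (the quotient by an open subgroup is finite, `ℤ` is not).
[cite: MochizukiEtTh2009, §1 p.12] -/
theorem ThetaSetting.not_compactSpace_piTemp (D : ThetaSetting p) : ¬ CompactSpace D.PiTemp := by
  intro hc
  have hfin : Finite (D.PiTemp ⧸ D.toZ.ker) := Subgroup.quotient_finite_of_isOpen _ D.isOpen_ker_toZ
  have hZ : Finite (Multiplicative ℤ) :=
    Finite.of_equiv _ (QuotientGroup.quotientKerEquivOfSurjective D.toZ D.toZ_surjective).toEquiv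
  have : Finite ℤ := Finite.of_equiv _ Multiplicative.toAdd
  exact Infinite.not_finite this

/-- **The degenerate `TemperedCurve` (`Π^temp := G_{ℚ_p}`) underlies no `ThetaSetting`**: `G_{ℚ_p}` is compact
(it is its own profinite completion, `isProfiniteCompletion_id_GQp`). [cite: MochizukiEtTh2009, §1 p.12] -/
theorem ThetaSetting.toTemperedCurve_ne_degenerate (D : ThetaSetting p) :
    D.toTemperedCurve ≠ TemperedCurve.degenerate p := by
  intro h
  apply D.not_compactSpace_piTemp
  rw [h]
  exact (isProfiniteCompletion_id_GQp p).compactSpace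

/-- Hence a `ThetaSetting` can only sit over a `TemperedCurve` other than the degenerate one: the set of
`TemperedCurve`s underlying some `ThetaSetting` misses `TemperedCurve.degenerate p`.
[cite: MochizukiEtTh2009, §1 p.12] -/
theorem TemperedCurve.degenerate_not_mem_range_toTemperedCurve :
    TemperedCurve.degenerate p ∉ Set.range (ThetaSetting.toTemperedCurve (p := p)) := by
  rintro ⟨D, hD⟩
  exact D.toTemperedCurve_ne_degenerate hD

end Literature.AnabelianGeometry.EtaleTheta
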